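import Literature.Computability.MetaComplexity.EFModMulU
import HarnessLib

/-!
# Congruence of uniform modular multiplication in extended Frege

Layer E/2 (uniform variant): two modular multipliers (`EFModMulU.lean`) with provably equal
operands and moduli have provably equal partial products at every stage, hence equal outputs
(`ModMulU.PairData.isBlock_lines`, conclusion `PairData.mem_lines`). The block is the
concatenation over the stages of: congruence of the doubling adders
(`ModAddU.PairData.isBlock_leibLines`), congruence of the masks (the Leibniz rule of `∧`,
`Netlist.rLeib Kind.and`), congruence of the accumulating adders — an induction over the stages
carried out in the metalanguage (`PairData.isBlock_upTo`). No scratch circuits.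

## Sources

* S. A. Cook, R. A. Reckhow, *The relative efficiency of propositional proof systems*,
  J. Symbolic Logic 44 (1979), §2 (sound schematic rules), Def. 4.1.
-/

namespace Literature.Computability.MetaComplexity

open _root_.Computability Complexity Complexity.PropForm Netlist

namespace ModMulU

variable {G : FregeSystem} {K : PropForm ℕ} {Γ : Set (PropForm ℕ)}

/-- Two modular multipliers of the same width. [folklore] -/
structure PairData where
  /-- the first multiplier -/
  V₁ : View
  /-- the second multiplier -/
  V₂ : View
  /-- their width -/
  L : ℕ

namespace PairData

variable (d : PairData)

/-- The pair of doubling adders of stage `s`. [folklore] -/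
def pD (s : ℕ) : ModAddU.PairData := ⟨d.V₁.Dv d.L s, d.V₂.Dv d.L s, d.L⟩
/-- The pair of accumulating adders of stage `s`. [folklore] -/
def pA (s : ℕ) : ModAddU.PairData := ⟨d.V₁.Av d.L s, d.V₂.Av d.L s, d.L⟩

/-- The congruence lines of the masks of stage `s`. [folklore] -/
def maskLines (K : PropForm ℕ) (s : ℕ) : List (PropForm ℕ) :=
  (List.range d.L).map fun i => ctx K (eqv (d.V₁.msk d.L s i) (d.V₂.msk d.L s i))

/-- The lines of stage `s`: doubling adders, masks, accumulating adders. [folklore] -/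
def stageLines (K : PropForm ℕ) (s : ℕ) : List (PropForm ℕ) :=
  (d.pD s).leibLines K ++ (d.maskLines K s ++ (d.pA s).leibLines K)

/-- The lines up to stage `s`: the zero gates, then the stages `0 … s-1`. [folklore] -/
def upTo (K : PropForm ℕ) : ℕ → List (PropForm ℕ)
  | 0 => [ctx K (eqv d.V₁.z d.V₂.z)]
  | s + 1 => upTo K s ++ d.stageLines K s

/-- All lines of the congruence law. [folklore] -/
def lines (K : PropForm ℕ) : List (PropForm ℕ) := d.upTo K d.L

/-- The equality of the partial products `P_s` is among the lines up to `s`. [folklore] -/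
theorem mem_upTo {s i : ℕ} (hi : i < d.L) : ctx K (eqv (d.V₁.P d.L s i) (d.V₂.P d.L s i)) ∈ d.upTo K s := by
  cases s with
  | zero => exact List.mem_singleton_self _
  | succ s =>
    rw [View.P_succ, View.P_succ]
    exact List.mem_append_right _ (List.mem_append_right _ (List.mem_append_right _
      ((d.pA s).mem_leibLines hi)))

/-- Earlier prefixes are contained in later ones. [folklore] -/
theorem upTo_subset {s t : ℕ} (h : s ≤ t) : ∀ χ ∈ d.upTo K s, χ ∈ d.upTo K t := by
  induction h with
  | refl => exact fun χ hχ => hχ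
  | step _ ih => exact fun χ hχ => List.mem_append_left _ (ih χ hχ)

/-- **Congruence up to stage `s`.** [cite: CookReckhow1979, §2] -/
theorem isBlock_upTo (hGN : ∀ r ∈ Netlist.rules, r ∈ G.rules) (hGL : ∀ r ∈ Logic.rules, r ∈ G.rules)
    (h₁ : d.V₁.Avail d.L K Γ) (h₂ : d.V₂.Avail d.L K Γ) (ha : ∀ i < d.L, ctx K (eqv (d.V₁.a i) (d.V₂.a i)) ∈ Γ)
    (hb : ∀ i < d.L, ctx K (eqv (d.V₁.b i) (d.V₂.b i)) ∈ Γ) (hn : ∀ i < d.L, ctx K (eqv (d.V₁.n i) (d.V₂.n i)) ∈ Γ) :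
    ∀ s ≤ d.L, G.IsBlock Γ (d.upTo K s) := by
  intro s hs
  induction s with
  | zero =>
    -- the two zero gates are equal (both `⊥`)
    exact FregeSystem.IsBlock.singleton (Or.inr (FregeSystem.IsInferredFrom.of_rule
      (hGN _ (rLeib_mem_rules (Kind.cst false)))
      (FregeSystem.sub [K, var d.V₁.z, const true, const true, const true, var d.V₂.z]) rfl
      (FregeSystem.prems_cons h₁.hz (FregeSystem.prems_cons h₂.hz FregeSystem.prems_nil))))
  | succ s ih =>
    have hsL : s < d.L := by omega
    have hP : ∀ i < d.L, ctx K (eqv (d.V₁.P d.L s i) (d.V₂.P d.L s i)) ∈ Γ ∪ {χ | χ ∈ d.upTo K s} :=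
      fun i hi => Or.inr (d.mem_upTo hi)
    rw [upTo]
    refine (ih (by omega)).append ?_
    -- stage `s`
    refine ((d.pD s).isBlock_leibLines hGN hGL ((h₁.hD s hsL).mono Set.subset_union_left)
      ((h₂.hD s hsL).mono Set.subset_union_left) hP hP (fun i hi => Or.inl (hn i hi))).append
      ((Scaffold.isBlock_of_forall fun θ hθ => ?_).append ((d.pA s).isBlock_leibLines hGN hGL
        ((h₁.hA s hsL).mono ?_) ((h₂.hA s hsL).mono ?_) (fun i hi => ?_) (fun i hi => ?_) (fun i hi => ?_)))
    · obtain ⟨i, hi, rfl⟩ := List.mem_map.1 hθ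
      rw [List.mem_range] at hi
      exact Or.inr (FregeSystem.IsInferredFrom.of_rule (hGN _ (rLeib_mem_rules Kind.and))
        (FregeSystem.sub [K, var (d.V₁.msk d.L s i), var (d.V₁.b (d.L - 1 - s)), var (d.V₁.a i), const true,
          var (d.V₂.msk d.L s i), var (d.V₂.b (d.L - 1 - s)), var (d.V₂.a i), const true]) rfl
        (FregeSystem.prems_cons (Or.inl (Or.inl (h₁.hmk s hsL i hi))) (FregeSystem.prems_cons
          (Or.inl (Or.inl (h₂.hmk s hsL i hi))) (FregeSystem.prems_cons (Or.inl (Or.inl (hb _ (by omega))))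
          (FregeSystem.prems_cons (Or.inl (Or.inl (ha i hi))) FregeSystem.prems_nil)))))
    · exact fun χ hχ => Or.inl (Or.inl (Or.inl hχ))
    · exact fun χ hχ => Or.inl (Or.inl (Or.inl hχ))
    · exact Or.inl (Or.inr ((d.pD s).mem_leibLines hi))
    · exact Or.inr (List.mem_map.2 ⟨i, List.mem_range.2 hi, rfl⟩)
    · exact Or.inl (Or.inl (Or.inl (hn i hi)))

/-- **Congruence of modular multiplication inside Frege**: multipliers with provably equal
operands and moduli have provably equal partial products and outputs. [cite: CookReckhow1979, §2] -/
theorem isBlock_lines (hGN : ∀ r ∈ Netlist.rules, r ∈ G.rules) (hGL : ∀ r ∈ Logic.rules, r ∈ G.rules)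
    (h₁ : d.V₁.Avail d.L K Γ) (h₂ : d.V₂.Avail d.L K Γ) (ha : ∀ i < d.L, ctx K (eqv (d.V₁.a i) (d.V₂.a i)) ∈ Γ)
    (hb : ∀ i < d.L, ctx K (eqv (d.V₁.b i) (d.V₂.b i)) ∈ Γ) (hn : ∀ i < d.L, ctx K (eqv (d.V₁.n i) (d.V₂.n i)) ∈ Γ) :
    G.IsBlock Γ (d.lines K) :=
  d.isBlock_upTo hGN hGL h₁ h₂ ha hb hn d.L le_rfl

/-- The conclusion: the outputs are provably equal. [folklore] -/
theorem mem_lines {i : ℕ} (hi : i < d.L) : ctx K (eqv (d.V₁.out d.L i) (d.V₂.out d.L i)) ∈ d.lines K :=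
  d.mem_upTo hi

/-- The partial products are provably equal, in the lines. [folklore] -/
theorem mem_lines_P {s i : ℕ} (hs : s ≤ d.L) (hi : i < d.L) :
    ctx K (eqv (d.V₁.P d.L s i) (d.V₂.P d.L s i)) ∈ d.lines K :=
  d.upTo_subset hs _ (d.mem_upTo hi)

/-- Size of a stage. [folklore] -/
theorem proofSize_stageLines (s : ℕ) : proofSize (d.stageLines K s) ≤ (13 * d.L + 4) * (K.size + 10) := by
  rw [stageLines, proofSize_append, proofSize_append]
  have h₁ : proofSize ((d.pD s).leibLines K) ≤ (6 * d.L + 2) * (K.size + 10) := (d.pD s).proofSize_leibLines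
  have h₂ : proofSize ((d.pA s).leibLines K) ≤ (6 * d.L + 2) * (K.size + 10) := (d.pA s).proofSize_leibLines
  have h₃ : proofSize (d.maskLines K s) ≤ d.L * (K.size + 10) :=
    proofSize_map_range_le fun i _ => by simp [ctx, eqv, size, FregeSystem.size_biimp]
  nlinarith [h₁, h₂, h₃]

/-- Size up to stage `s`. [folklore] -/
theorem proofSize_upTo : ∀ s, proofSize (d.upTo K s) ≤ (K.size + 10) + s * ((13 * d.L + 4) * (K.size + 10))
  | 0 => by simp [upTo, proofSize, ctx, eqv, size, FregeSystem.size_biimp]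
  | s + 1 => by
    rw [upTo, proofSize_append]
    nlinarith [proofSize_upTo s, d.proofSize_stageLines (K := K) s]

/-- **Size of the congruence law**: `O(L² · (|K| + 1))`. [folklore] -/
theorem proofSize_lines : proofSize (d.lines K) ≤ (K.size + 10) + d.L * ((13 * d.L + 4) * (K.size + 10)) :=
  d.proofSize_upTo d.L

end PairData

end ModMulU

end Literature.Computability.MetaComplexity
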